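import Mathlib
import Summits.QuantumAdvantage.AdviceFreeQNC0.TwoShotHard
import Summits.QuantumAdvantage.AdviceFreeQNC0.WalkCoreCharge
import Summits.QuantumAdvantage.AdviceFreeQNC0.ChargeRecursion
import Summits.QuantumAdvantage.AdviceFreeQNC0.OddPrimeWitnesses
import Literature.Computability.MetaComplexity.NegModqImmunity
import HarnessLib

/-!
# PumpDial, part A (sections Counts, NullCalculus, Unity, Design, Board) — support for item stmt-QuantumAdvantage-28487

Cell decomp-qadv, seat lens-4 («minimal counterexample / extremal reduction»), generation 25 — land port of the node
«PumpDial» (published under the cell's HOME/decomp-qadv-lens-4/g25/PumpDial.lean rev 3, sha256 59c460875773e61d…, record NODE-g25.md;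
RESIDUAL MODE on AbsorptionDial:28487 `NoPerfectPolyOdd`).  The node file with ONLY the namespace renamed
`Theses.PumpDial → Theorems.PumpDial`, `example`s dropped and one-line docstrings added where missing, cut into chain-imported parts;
the X-side junction theorems (conclusion `AbsorptionDial.NoPerfectPolyOdd` BY NAME) live in the LAST part, the only one importing
`Theses.AbsorptionDial`; every other part imports only `AdviceFreeQNC0.*`, `Literature.Computability.MetaComplexity.*`, HarnessLib, Mathlib
(no import path to any Theses file — checked on the tree's import lines), so route items can be typed BY NAME over these parts.
No `sorry`, no new axioms, no instances, no notation.

This part: `Strat` … `perfAt_complS` (46 declarations).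
-/

set_option autoImplicit false
set_option linter.dupNamespace false

noncomputable section

namespace Summit.QuantumAdvantage.QuantumAdvantage.Theorems.PumpDial
open Classical
open Finset
open Summit.QuantumAdvantage.AdviceFreeQNC0
open Summit.QuantumAdvantage.AdviceFreeQNC0.TwoShot
open Summit.QuantumAdvantage.AdviceFreeQNC0.CharK
open Literature.Computability.MetaComplexity Literature.Computability.MetaComplexity.Smolensky

/-! # PART I — UnityDial (generation 24) VERBATIM: §§1–6, the Boolean board calculus, the K-pieces `A_K`, `B_K`,
the deciding theorem `closes : A_K → B_K → X`, the `p = 3` calibration.  (sha256 of g24/UnityDial.lean recorded in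
NODE-g25.md; nothing below in Part I is changed.) -/

/-- a u-walk strategy on `n` bits: one Boolean cut function per cut `g ∈ {0,…,n}`. -/
abbrev Strat (n : ℕ) : Type := Fin (n + 1) → (Fin n → Bool) → Bool

section Counts

variable {n : ℕ}

/-! ## §1 Counts: fires and live fires -/

/-- number of fires `S(u) = #{g : y_g(u) = 1}`. -/
def shots (y : Strat n) (u : Fin n → Bool) : ℕ :=
  (univ.filter fun g : Fin (n + 1) => y g u = true).card

/-- number of LIVE fires `T(u) = #{g : y_g(u) = 1 ∧ c + g + e_g(u) ≢ 0 (mod 3)}` (= `TwoShot.count`). -/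
def liveCount (c : ℕ) (y : Strat n) (u : Fin n → Bool) : ℕ :=
  TwoShot.count c y u

/-- `liveCount_eq` (PumpDial g25, section Counts). -/
theorem liveCount_eq (c : ℕ) (y : Strat n) (u : Fin n → Bool) :
    liveCount c y u =
      (univ.filter fun g : Fin (n + 1) => y g u = true ∧ (c + g.val + walkExp u g.val) % 3 ≠ 0).card := rfl

/-- `liveCount_le_shots` (PumpDial g25, section Counts). -/
theorem liveCount_le_shots (c : ℕ) (y : Strat n) (u : Fin n → Bool) : liveCount c y u ≤ shots y u := by
  rw [liveCount_eq]
  exact Finset.card_le_card (Finset.monotone_filter_right _ fun g _ h => h.1)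

/-- the game is the parity of the live count. -/
theorem ringWinU_eq_true_iff (c : ℕ) (y : Strat n) (u : Fin n → Bool) :
    ringWinU c y u = true ↔ liveCount c y u % 2 = 1 := by
  rw [TwoShot.ringWinU_eq, decide_eq_true_eq]; rfl

/-- `ringWinU_eq_false_iff` (PumpDial g25, section Counts). -/
theorem ringWinU_eq_false_iff (c : ℕ) (y : Strat n) (u : Fin n → Bool) :
    ringWinU c y u = false ↔ liveCount c y u % 2 = 0 := by
  rw [← Bool.not_eq_true, ringWinU_eq_true_iff]; omega

/-- one live fire wins. -/
theorem ringWinU_of_liveCount_eq_one {c : ℕ} {y : Strat n} {u : Fin n → Bool}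
    (h : liveCount c y u = 1) : ringWinU c y u = true := by
  rw [ringWinU_eq_true_iff, h]

/-- a loss has live count `≠ 1`. -/
theorem liveCount_ne_one_of_loss {c : ℕ} {y : Strat n} {u : Fin n → Bool}
    (h : ringWinU c y u = false) : liveCount c y u ≠ 1 := by
  intro h1
  have := ringWinU_of_liveCount_eq_one h1
  rw [h] at this
  exact Bool.false_ne_true this

/-- a winning strategy with at most one fire has exactly one live fire. -/
theorem liveCount_eq_one_of_win_of_shots_le_one {c : ℕ} {y : Strat n} {u : Fin n → Bool}
    (hwin : ringWinU c y u = true) (hs : shots y u ≤ 1) : liveCount c y u = 1 := by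
  rw [ringWinU_eq_true_iff] at hwin
  have hle := liveCount_le_shots c y u
  omega

/-- `Perfect c y`: the strategy wins the charge-`c` game on EVERY input. -/
def Perfect (c : ℕ) (y : Strat n) : Prop := ∀ u, ringWinU c y u = true

/-- `Null c z`: the strategy LOSES on every input (even live count everywhere). -/
def Null (c : ℕ) (z : Strat n) : Prop := ∀ u, ringWinU c z u = false

/-- `OneLive c y`: exactly one live fire on every input (the extremal perfect shape). -/
def OneLive (c : ℕ) (y : Strat n) : Prop := ∀ u, liveCount c y u = 1

/-- `perfect_of_oneLive` (PumpDial g25, section Counts). -/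
theorem perfect_of_oneLive {c : ℕ} {y : Strat n} (h : OneLive c y) : Perfect c y :=
  fun u => ringWinU_of_liveCount_eq_one (h u)

end Counts

section NullCalculus

variable {n : ℕ}

/-! ## §2 The null calculus and THE WALL (why every degree-tied normal-form reduction is vacuous) -/

/-- pointwise XOR of two strategies. -/
def bxorS (y z : Strat n) : Strat n := fun g u => xor (y g u) (z g u)

/-- `bxorS_bxorS_cancel` (PumpDial g25, section NullCalculus). -/
theorem bxorS_bxorS_cancel (y z : Strat n) : bxorS y (bxorS y z) = z := by
  funext g u; unfold bxorS; cases y g u <;> cases z g u <;> rfl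

/-- `bxorS_comm` (PumpDial g25, section NullCalculus). -/
theorem bxorS_comm (y z : Strat n) : bxorS y z = bxorS z y := by
  funext g u; unfold bxorS; cases y g u <;> cases z g u <;> rfl

/-- THE COSET LAW (tree `ringWinU_xor`): the game is `𝔽₂`-linear in the strategy. -/
theorem ringWinU_bxorS (c : ℕ) (y z : Strat n) (u : Fin n → Bool) :
    ringWinU c (bxorS y z) u = xor (ringWinU c y u) (ringWinU c z u) :=
  ringWinU_xor n c y z u

/-- degrees add under XOR: `𝟙[y ⊻ z] = Y + Z − 2·Y·Z`. -/
theorem hasDegF_bxorS {p : ℕ} [Fact p.Prime] {d e : ℕ} {y z : Strat n} {g : Fin (n + 1)}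
    (hy : HasDegF p (y g) d) (hz : HasDegF p (z g) e) : HasDegF p (bxorS y z g) (d + e) := by
  unfold HasDegF at hy hz ⊢
  have key : (fun x => if bxorS y z g x = true then (1 : ZMod p) else 0) =
      (fun x => if y g x = true then (1 : ZMod p) else 0) + (fun x => if z g x = true then (1 : ZMod p) else 0)
        - (2 : ZMod p) • ((fun x => if y g x = true then (1 : ZMod p) else 0) *
            (fun x => if z g x = true then (1 : ZMod p) else 0)) := by
    funext x
    simp only [bxorS, Pi.add_apply, Pi.sub_apply, Pi.smul_apply, Pi.mul_apply, smul_eq_mul]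
    rcases Bool.eq_false_or_eq_true (y g x) with h1 | h1 <;>
      rcases Bool.eq_false_or_eq_true (z g x) with h2 | h2 <;> simp [h1, h2]
    ring
  rw [key]
  exact Submodule.sub_mem _
    (Submodule.add_mem _ (lowDeg_mono (Nat.le_add_right d e) hy) (lowDeg_mono (Nat.le_add_left e d) hz))
    (Submodule.smul_mem _ _ (mul_mem_lowDeg_add hy hz))

/-- two perfect strategies differ by a null one. -/
theorem null_bxorS_of_perfect {c : ℕ} {y y' : Strat n} (hy : Perfect c y) (hy' : Perfect c y') :
    Null c (bxorS y y') := by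
  intro u; rw [ringWinU_bxorS, hy u, hy' u]; rfl

/-- perfect ⊻ null is perfect. -/
theorem perfect_bxorS_null {c : ℕ} {y z : Strat n} (hy : Perfect c y) (hz : Null c z) :
    Perfect c (bxorS y z) := by
  intro u; rw [ringWinU_bxorS, hy u, hz u]; rfl

/-- **THE WALL.**  Let `N` be ANY «normal form» predicate on strategies of the SAME board.  If the board carries ONE
perfect strategy `y'` in normal form of degree `e`, then EVERY perfect strategy `y` of degree `d` on that board is
brought into normal form by XOR-ing a NULL strategy of degree `≤ d + e` (namely `z = y ⊻ y'`).  Consequently a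
reduction «perfect degree-`d` ⟹ ∃ normal-form perfect of degree `≤ F(d)`», for any budget `F(d) ≥ d + e`, carries no
information beyond «the board has SOME normal-form perfect strategy of degree `e`» — which is the negation of the
companion hardness piece.  This is the mechanism behind OBJECTION 66v41 (`a_of_not_b`), and it kills every re-tie
by a degree budget; only ties that a null XOR cannot certify (Booleanity-transcending ones) survive — §3. -/
theorem wall {p : ℕ} [Fact p.Prime] {d e c : ℕ} (N : Strat n → Prop)
    (hw : ∃ y', N y' ∧ Perfect c y' ∧ ∀ g, HasDegF p (y' g) e)
    (y : Strat n) (hy : Perfect c y) (hdeg : ∀ g, HasDegF p (y g) d) :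
    ∃ z, Null c z ∧ (∀ g, HasDegF p (z g) (d + e)) ∧ N (bxorS y z) ∧ Perfect c (bxorS y z) := by
  obtain ⟨y', hN, hy', hdeg'⟩ := hw
  refine ⟨bxorS y y', null_bxorS_of_perfect hy hy', fun g => hasDegF_bxorS (hdeg g) (hdeg' g), ?_, ?_⟩
  · rw [bxorS_bxorS_cancel]; exact hN
  · rw [bxorS_bxorS_cancel]; exact hy'

end NullCalculus

section Unity

variable {n : ℕ}

/-! ## §3 The K-linear UNITY relaxation (the linear shadow of «one live fire everywhere») -/

/-- the liveness indicator of cut `g` at charge `c` as a `K`-valued function of the input: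
`liveInd K c g u = 𝟙[c + g + e_g(u) ≢ 0 (mod 3)]`.  NOT low degree (a MOD-3 function of the walk). -/
def liveInd (K : Type*) [Field K] (c : ℕ) (g : Fin (n + 1)) : CubeFn K n :=
  fun u => if (c + g.val + walkExp u g.val) % 3 ≠ 0 then 1 else 0

/-- **`UnityAt K n c d` — a K-LINEAR UNITY of degree `d` on the board `(n, c)`**: `K`-valued cut functions `Y_g`
of degree `≤ d` with `Σ_g Y_g(u)·𝟙[cut g live at u] = 1` for EVERY input `u`.  A Boolean strategy with exactly
one live fire everywhere is a `{0,1}`-valued unity (`unity_of_oneLive`); a unity is what the tree's K-character /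
linear methods actually see of such a strategy. Pure linear algebra over `K`: for fixed `(n, c, d)` a finite linear
system (instrument `data/unity_lin.py`). -/
def UnityAt (K : Type*) [Field K] (n c d : ℕ) : Prop :=
  ∃ Y : Fin (n + 1) → CubeFn K n, (∀ g, Y g ∈ lowDeg K n d) ∧ ∀ u, (∑ g, Y g u * liveInd K c g u) = 1

/-- `unityAt_mono` (PumpDial g25, section Unity). -/
theorem unityAt_mono (K : Type*) [Field K] {c d d' : ℕ} (h : d ≤ d') (hU : UnityAt K n c d) :
    UnityAt K n c d' := by
  obtain ⟨Y, hY, h1⟩ := hU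
  exact ⟨Y, fun g => lowDeg_mono h (hY g), h1⟩

/-- the live count is the `K`-bilinear pairing of the indicator cut functions with the liveness indicators. -/
theorem sum_yK_mul_liveInd (K : Type*) [Field K] (c : ℕ) (y : Strat n) (u : Fin n → Bool) :
    (∑ g, yK K y g u * liveInd K c g u) = (liveCount c y u : K) := by
  rw [liveCount_eq, Finset.card_filter]
  push_cast
  refine Finset.sum_congr rfl fun g _ => ?_
  unfold yK ιK liveInd
  by_cases h1 : y g u = true <;> by_cases h2 : (c + g.val + walkExp u g.val) % 3 ≠ 0 <;> simp [h1, h2]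

/-- **LAW (one-live ⟹ unity)**: a Boolean strategy of `𝔽_p`-degree `d` with exactly one live fire on every input IS a
unity of degree `d` over every field of characteristic `p`. -/
theorem unity_of_oneLive {p : ℕ} [Fact p.Prime] (K : Type*) [Field K] [CharP K p] {c d : ℕ} {y : Strat n}
    (hdeg : ∀ g, HasDegF p (y g) d) (h1 : OneLive c y) : UnityAt K n c d :=
  ⟨fun g => yK K y g, fun g => yK_mem_lowDeg y g (hdeg g), fun u => by
    rw [sum_yK_mul_liveInd, h1 u, Nat.cast_one]⟩

/-- contrapositive: NO unity of degree `d` on the board ⟹ NO one-live Boolean strategy of degree `d` there. -/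
theorem not_oneLive_of_not_unity {p : ℕ} [Fact p.Prime] {c d : ℕ} (h : ¬ UnityAt (ZMod p) n c d)
    (y : Strat n) (hdeg : ∀ g, HasDegF p (y g) d) : ∃ u, liveCount c y u ≠ 1 := by
  by_contra hall
  push Not at hall
  exact h (unity_of_oneLive (ZMod p) hdeg hall)

/-- more generally a unity only needs the live count `≡ 1 (mod p)` everywhere («`p`-tidy»). -/
theorem unity_of_tidy {p : ℕ} [Fact p.Prime] {c d : ℕ} {y : Strat n}
    (hdeg : ∀ g, HasDegF p (y g) d) (h1 : ∀ u, liveCount c y u % p = 1) : UnityAt (ZMod p) n c d :=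
  ⟨fun g => yK (ZMod p) y g, fun g => yK_mem_lowDeg y g (hdeg g), fun u => by
    rw [sum_yK_mul_liveInd]
    have h := h1 u
    have : ((liveCount c y u : ℕ) : ZMod p) = ((liveCount c y u % p : ℕ) : ZMod p) := by
      rw [ZMod.natCast_mod]
    rw [this, h, Nat.cast_one]⟩

end Unity

section Design

variable {n : ℕ}

/-! ## §3b DESIGNS — the dual certificate («certificate by dual witness»; Krajíček, *Proof Complexity* §16.1:
a degree-`t` design kills every Nullstellensatz certificate of degree `≤ t`, L.16.1.1; BIKPRS / Beame et al. for
`Count₃`, Thm 16.1.2, L.16.1.4–16.1.5).  DICTIONARY: axioms `f` ↦ the liveness indicators `live_g` (high degree, free);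
NS certificate `Σ h_f f = 1` of degree `t` ↦ a unity `Σ_g Y_g live_g = 1` with `deg Y_g ≤ d` (only the COEFFICIENT degree
is charged); degree-`t` design ↦ `DesignAt K n c d`.  Over a field the two are EXACTLY dual (`designAt_iff_not_unityAt`,
finite-dimensional separation `Submodule.exists_dual_map_eq_bot_of_notMem`), so piece `B_K` («no polylog unity on large
hard boards») is EQUIVALENTLY the CONSTRUCTIVE statement «exhibit a polylog-degree design on every large hard board». -/

/-- the unity map `Y ↦ Σ_g Y_g · live_g`, `K`-linear in the tuple of cut functions. -/
def unityMap (K : Type*) [Field K] (n c : ℕ) : (Fin (n + 1) → CubeFn K n) →ₗ[K] CubeFn K n where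
  toFun Y := ∑ g, Y g * liveInd K c g
  map_add' Y Z := by
    simp only [Pi.add_apply, add_mul, Finset.sum_add_distrib]
  map_smul' a Y := by
    simp only [Pi.smul_apply, smul_mul_assoc, RingHom.id_apply, Finset.smul_sum]

/-- `unityMap_apply` (PumpDial g25, section Design). -/
@[simp] theorem unityMap_apply (K : Type*) [Field K] (c : ℕ) (Y : Fin (n + 1) → CubeFn K n) :
    unityMap K n c Y = ∑ g, Y g * liveInd K c g := rfl

/-- the `K`-span of the degree-`≤ d` multiples of the liveness indicators (= image of `Π_g lowDeg d` under `unityMap`). -/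
def unitySpan (K : Type*) [Field K] (n c d : ℕ) : Submodule K (CubeFn K n) :=
  (Submodule.pi Set.univ (fun _ : Fin (n + 1) => lowDeg K n d)).map (unityMap K n c)

/-- `unityAt_iff_one_mem` (PumpDial g25, section Design). -/
theorem unityAt_iff_one_mem (K : Type*) [Field K] (c d : ℕ) :
    UnityAt K n c d ↔ (1 : CubeFn K n) ∈ unitySpan K n c d := by
  constructor
  · rintro ⟨Y, hY, h1⟩
    refine Submodule.mem_map.mpr ⟨Y, Submodule.mem_pi.mpr fun g _ => hY g, ?_⟩
    funext u
    simpa [Finset.sum_apply] using h1 u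
  · intro hmem
    obtain ⟨Y, hY, hYeq⟩ := Submodule.mem_map.mp hmem
    refine ⟨Y, fun g => Submodule.mem_pi.mp hY g (Set.mem_univ _), fun u => ?_⟩
    have := congrFun hYeq u
    simpa [Finset.sum_apply] using this

/-- **`DesignAt K n c d`** — a degree-`d` DESIGN for the board `(n, c)`: a `K`-linear functional on input functions with
`D 1 = 1` that kills every degree-`≤ d` multiple of every liveness indicator. -/
def DesignAt (K : Type*) [Field K] (n c d : ℕ) : Prop :=
  ∃ D : CubeFn K n →ₗ[K] K, D 1 = 1 ∧ ∀ g : Fin (n + 1), ∀ m ∈ lowDeg K n d, D (m * liveInd K c g) = 0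

/-- soundness (Krajíček L.16.1.1 in our dictionary): a design kills every unity of its degree. -/
theorem not_unityAt_of_designAt (K : Type*) [Field K] {c d : ℕ} (h : DesignAt K n c d) : ¬ UnityAt K n c d := by
  rintro ⟨Y, hY, hsum⟩
  obtain ⟨D, hD1, hD0⟩ := h
  have hfun : (∑ g, Y g * liveInd K c g) = (1 : CubeFn K n) := by
    funext u
    simpa [Finset.sum_apply] using hsum u
  have h0 : D (∑ g, Y g * liveInd K c g) = 0 := by
    rw [map_sum]
    exact Finset.sum_eq_zero fun g _ => hD0 g (Y g) (hY g)
  rw [hfun, hD1] at h0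
  exact one_ne_zero h0

/-- completeness (finite-dimensional duality): if the board has NO unity of degree `d`, it HAS a degree-`d` design. -/
theorem designAt_of_not_unityAt (K : Type*) [Field K] {c d : ℕ} (h : ¬ UnityAt K n c d) : DesignAt K n c d := by
  classical
  have h1 : (1 : CubeFn K n) ∉ unitySpan K n c d := fun hmem => h ((unityAt_iff_one_mem K c d).mpr hmem)
  obtain ⟨f, hf1, hf0⟩ := Submodule.exists_dual_map_eq_bot_of_notMem h1 inferInstance
  refine ⟨(f 1)⁻¹ • f, by rw [LinearMap.smul_apply, smul_eq_mul, inv_mul_cancel₀ hf1], fun g m hm => ?_⟩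
  have hmem : m * liveInd K c g ∈ unitySpan K n c d := by
    refine Submodule.mem_map.mpr ⟨Pi.single g m, Submodule.mem_pi.mpr fun i _ => ?_, ?_⟩
    · by_cases hi : i = g
      · subst hi; simpa using hm
      · simp [Pi.single_eq_of_ne hi]
    · rw [unityMap_apply, Finset.sum_eq_single g (fun i _ hi => by simp [Pi.single_eq_of_ne hi]) (by simp)]
      simp
  have hzero : f (m * liveInd K c g) = 0 := by
    have h' : f (m * liveInd K c g) ∈ (unitySpan K n c d).map f := Submodule.mem_map_of_mem hmem
    rw [hf0] at h'
    exact (Submodule.mem_bot K).1 h'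
  rw [LinearMap.smul_apply, hzero, smul_zero]

/-- **DUALITY LAW**: designs and unities of the same degree on the same board are exactly complementary. -/
theorem designAt_iff_not_unityAt (K : Type*) [Field K] (c d : ℕ) : DesignAt K n c d ↔ ¬ UnityAt K n c d :=
  ⟨not_unityAt_of_designAt K, designAt_of_not_unityAt K⟩

/-- designs are downward closed in the degree. -/
theorem designAt_anti (K : Type*) [Field K] {c d d' : ℕ} (h : d ≤ d') (hD : DesignAt K n c d') : DesignAt K n c d :=
  (designAt_iff_not_unityAt K c d).mpr fun hU => (designAt_iff_not_unityAt K c d').mp hD (unityAt_mono K h hU)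

/-- a design kills every one-live BOOLEAN strategy of its degree (characteristic `p`). -/
theorem not_oneLive_of_designAt {p : ℕ} [Fact p.Prime] {c d : ℕ} (hD : DesignAt (ZMod p) n c d)
    (y : Strat n) (hdeg : ∀ g, HasDegF p (y g) d) : ∃ u, liveCount c y u ≠ 1 :=
  not_oneLive_of_not_unity (not_unityAt_of_designAt (ZMod p) hD) y hdeg

end Design

section Board

variable {n : ℕ}

/-! ## §4 Board calculus I (Boolean, PROVED): charge duality, first-bit gluing, every perfect board reaches the DIAGONAL -/

/-- `PerfAt p n c d`: the board `(n, c)` (length `n`, charge `c`) carries a PERFECT Boolean strategy of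
`𝔽_p`-degree `≤ d`. -/
def PerfAt (p : ℕ) [Fact p.Prime] (n c d : ℕ) : Prop :=
  ∃ y : Strat n, Perfect c y ∧ ∀ g, HasDegF p (y g) d

/-- `perfAt_mono` (PumpDial g25, section Board). -/
theorem perfAt_mono {p : ℕ} [Fact p.Prime] {c d d' : ℕ} (h : d ≤ d') (hP : PerfAt p n c d) : PerfAt p n c d' := by
  obtain ⟨y, hy, hdeg⟩ := hP
  exact ⟨y, hy, fun g => lowDeg_mono h (hdeg g)⟩

/-- the game depends on the charge only mod `3` (tree `ringWinU_charge_mod`). -/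
theorem perfAt_charge_mod {p : ℕ} [Fact p.Prime] {c c' d : ℕ} (h : c % 3 = c' % 3) (hP : PerfAt p n c d) :
    PerfAt p n c' d := by
  obtain ⟨y, hy, hdeg⟩ := hP
  exact ⟨y, fun u => by rw [← ringWinU_charge_mod h y u]; exact hy u, hdeg⟩

/-- the complemented strategy `u ↦ y(¬u)`. -/
def complS (y : Strat n) : Strat n := fun g w => y g (fun i => !(w i))

/-- `hasDegF_complS` (PumpDial g25, section Board). -/
theorem hasDegF_complS {p : ℕ} [Fact p.Prime] {d : ℕ} {y : Strat n} {g : Fin (n + 1)} (h : HasDegF p (y g) d) :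
    HasDegF p (complS y g) d := by
  unfold HasDegF at h ⊢
  refine AdviceFreeQNC0.comp_mem_lowDeg_of_coord (F := ZMod p) (fun u : Fin n → Bool => fun i => !(u i))
    (fun i => ?_) h
  have e : (fun u : Fin n → Bool => if (!(u i)) = true then (1 : ZMod p) else 0) = 1 - mono (ZMod p) {i} := by
    funext u
    simp only [Pi.sub_apply, Pi.one_apply, mono_apply, Finset.mem_singleton, forall_eq]
    rcases Bool.eq_false_or_eq_true (u i) with hb | hb <;> simp [hb]
  rw [e]
  exact Submodule.sub_mem _ (by rw [← mono_empty]; exact mono_mem_lowDeg (by simp)) (mono_mem_lowDeg (by simp))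

/-- CHARGE DUALITY (tree `ringWinU_compl`): complementing the input maps the board `(n, c)` isomorphically onto
`(n, c'')` with `c + c'' + n ≡ 0 (mod 3)`, cut `g ↦ g`, liveness preserved; perfect strategies go to perfect ones. -/
theorem perfect_complS {c c'' : ℕ} (hcc : (c + c'' + n) % 3 = 0) {y : Strat n} (hy : Perfect c y) :
    Perfect c'' (complS y) := fun u =>
  calc ringWinU c'' (complS y) u = ringWinU c y (fun i => !(u i)) := (ringWinU_compl n c c'' hcc y u).symm
    _ = true := hy _

/-- `perfAt_complS` (PumpDial g25, section Board). -/
theorem perfAt_complS {p : ℕ} [Fact p.Prime] {c c'' d : ℕ} (hcc : (c + c'' + n) % 3 = 0) (hP : PerfAt p n c d) :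
    PerfAt p n c'' d := by
  obtain ⟨y, hy, hdeg⟩ := hP
  exact ⟨complS y, perfect_complS hcc hy, fun g => hasDegF_complS (hdeg g)⟩

end Board

end Summit.QuantumAdvantage.QuantumAdvantage.Theorems.PumpDial
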